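import Summits.QuantumFields.BalabanUV.T4Continuum.Support.NE4ReadOutSocketTower
import Summits.QuantumFields.BalabanUV.T4Continuum.Support.OutputRateTowerInstance

/-!
# NE4ReadOutSocketTowerPerturbed — binder row NE4 (spine node U2) with row NE5's W1 read from PERTURBED FREE TOWERS: node
# U2's NE4 triple, its `InjectedRate` and the spine's `K`-uniform `URateUpTo K` with NO η-rate LAW binder of row NE2's type —
# displayed instead: row NE2's U = 1 bundle `FreeTowerLaws` and, PER BACKGROUND INDEX, its typed U ≠ 1 residual
# `PerturbationLaws` ((H-bd)/(H-cons)), the geometric defect constants and the coupling `‖t‖κP < 1`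
# (cell `pub-balaban`, T⁴-continuum fan-out, `HOME/BINDER-OWNERS.md` row NE4, owner lineage t4-ne4-p1, generation 34; fourth
# socket sibling — `NE4ReadOutSocket` / `…Insertion` / `…Tower` / `…Gaussian…` stay byte-unchanged)

HONEST FRAMING (T4-DAG PAGE 1).  The cell's T⁴ target is rung (B)+1: existence AND uniqueness of the ε → 0 limit of
gauge-invariant observables on a FIXED finite torus T⁴ — NOT infinite volume, NOT a mass gap, NOT the Clay problem.  The
spine estimate NE4 («η-rate of the full β_k», shape `T4CouplingMatching.ScaleShiftRate`) is NOT PRINTED in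
[Balaban1987RG1]–[Balaban1989LargeFieldII] (print bounds the SIZE of the new term of one renormalization step, never a
modulus of continuity of the one-step map in the older terms; lineage record `t4/T4-EST-NE4-P1.md` §1 (S5)) and is NOT
PROVED here: node U2 is DEPENDENT — (R)∘{NE5, NE9}.  Row NE2's inequalities (H-bd)/(H-cons) for Bałaban's covariant
`P(U) = Δ_a(U) − Δ_a` are NOT PRINTED ([Balaban1985BackgroundPropagators] prints η-uniform bounds only; GAPS G-t4-U1a-1) and
NOT PROVED: they are the HYPOTHESIS SHAPE `BackgroundResolventTower.PerturbationLaws`, displayed below per background index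
and asserted by nobody; NE9, NE3 and row NE5's remaining walls are the cell's own estimates, NOT PRINTED, NOT PROVED (spine
estimates proved: 0/9, unchanged by this module).  Nothing printed is asserted; no «…» quotation is introduced (0 cite
tags).  `FlowStep.BetaPertH`, (B), (B^μ) do not occur and are NOT hidden: they live in the window `W` / the runs of whoever
instantiates.  HONEST DEPENDENCY (cell, verbatim): continuum YM on T⁴ ⇐ BetaPertH ∧ nine spine estimates (0/9 proved);
BetaPertH ⇐ (D1) ∧ (D4) ∧ CAP+tail; G-an2-4 gates asym, D1 and NE2/3/4.  (Row NE2, generation 9, records that its U ≠ 1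
layer is NOT gated by G-an2-4 — a U = 1 row —; on the resolvent route its residual is `PerturbationLaws`; the banner's
reconciliation is the carver's, t4-ref2 C-t4r2-292.)

WHAT THIS MODULE IS.  `NE4ReadOutSocketTower` (generation 30, p204070) plugged row NE5's tower-split W1 — row NE2's one-step
averaged LAW over a family of towers, `OutputRateTowerSocket.TowerLaw A Xt r Cop θ₂` (a binder `hlaw` of η-RATE type), ∧
row NE3's `LocalRate` — into node U2.  Row NE2 generation 9 opened the U ≠ 1 layer by the RESOLVENT ROUTE
(`Spine/BackgroundResolventTower`: perturbed free towers `(D_k + t·P_k)⁻¹`, `oneStepAveragedLaw_perturbed` ⇐ `FreeTowerLaws`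
∧ `PerturbationLaws` ∧ `‖t‖κ < 1`), and row NE5 generation 27 INSTANTIATED its socket's law BY NAME
(`Support/OutputRateTowerInstance`, p205877: `towerLaw_perturbed`, `towerContracting_perturbed`, `Cpert_nonneg`; END faces
`ne5_at_of_perturbed_{lip,split}_readsIns_nat`).  This leaf is node U2's side of that event and nothing else: the three
theorems of `NE4ReadOutSocketTower` with `A := fun _ => A`, `Xt := pertTower D P t`, `Cop := Cpert κP C₀ C₁ C₂ C_f t`,
`hAt := towerContracting_perturbed hfree`, `hlaw := towerLaw_perturbed …`, `hCop := Cpert_nonneg …` — so that the list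
DISPLAYED at node U2 carries, of row NE2's type, NO law: §1 `ne4_of_endNE9_perturbedSplitIns` (the row's TRIPLE
`ScaleShiftRate (cr·C₅·θ₅) θ₅ γ β ∧ HistLipschitz (cr·Λ(·+1)) γ β ∧ FadingMemory (cr·(ℓ/ν)·ν) ν (cr·Λ(·+1))`, constant
`δ₁ := cR·Cpert(t)/r₀ + Λb·Cm` displayed as `hδ₁`); §2 `injectedRate_of_endNE9_perturbedSplitIns` (node U2's OUTPUT
`InjectedRate (2(cr·C₅·θ₅)/(1 − ρ)) 0 ρ (disc of the runs)`, gap route, NO asymptotic-freedom input); §3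
`uRateUpTo_of_endNE9_perturbedSplitIns` (the spine's `K`-UNIFORM `URateUpTo K`, tower pair and read-out family read from the
same perturbed towers).

WHAT REMAINS DISPLAYED AT NODE U2 after this leaf — its inputs of row-NE2 type are exactly: `hfree : FreeTowerLaws D A Jinj F r
e₀ e₁ f` (U = 1; a THEOREM for `Δ_a` + King's pairing, `NE2PerturbedLayer.freeTowerLaws_king`, row NE2 — consumed by name in
row NE5's planned `OutputRateTowerInstance` v1.1), `hpert : ∀ j, PerturbationLaws D (P j) Jinj κP (e₂ j)` (PER BACKGROUND INDEX;
NOT PRINTED for Bałaban's `Δ_a(U) − Δ_a`; discharged by row NE2 for planted potentials / first-order Lipschitz backgrounds —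
MODEL classes, not Bałaban's covariant operator), geometric defect constants `C₀ C₁ C₂ C_f` at the towers' rate `θ₂ ≤ θ₁`,
the coupling `‖t‖κP < 1` (GLOBAL small background — row NE2's stated scope; Bałaban's local small-field regime is NOT reached);
everything else as in `NE4ReadOutSocketTower`: row NE9's END binders (`TwoPointKP`, `hCup`, `hTcup`, explicit part,
`DecayExtract`/`PinBudget`, `hocc`; PROOF-INTERIOR of (B) per row NE9), row NE3's `LocalRate R₃ Cm θ₁`, row NE5's W2 / W2-ins
/ W3 / MI-R and the READINGS `ReadsTowerMid` (now: which law-abiding BACKGROUND INDEX the step's operator species is read from)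
/ `hLip` / `hdom` / `ReadsIns`; printed STRUCTURE `hA`/`hB`, `ScaleZeroFree`…`Factorises`, `hrepr`; printed TYPE `cr`, `cR`,
`Λb`, `r₀`, `Gi`; node U1/H3 runs/box/pin; (B)/(B^μ)/BetaPertH inside `W`; scalars: memory gap `ν < ρ`, window, S, reaches
`ρ₀`/`ρ₁`, `0 < θ₁`, `θ₂ ≤ θ₁ ≤ θ₅ ≤ ρ`.  ONE free carrier per family (several tori = a disjoint union, row NE5's §1).

WHAT IS PROVED: bookkeeping only (three applications of the generation-30 theorems to row NE5's generation-27 instance, BY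
NAME).  0 sorry; axioms ⊆ {propext, Classical.choice, Quot.sound}; imports the LANDED modules `Support/NE4ReadOutSocketTower`
(p204070) and `Support/OutputRateTowerInstance` (p205877) and modifies nothing of them.  NOT COVERED: `FreeTowerLaws` /
`PerturbationLaws` for any concrete carrier, `LocalRate` for minimisers, any W2/W3/MI-R binder for Bałaban's objects; NE2's
covariant carriers at two spacings (not in the tree), NE3, NE5, NE9, BetaPertH, (B), (B^μ).  Rung (B)+1 finite T⁴; NOT summit
progress.
-/

noncomputable section

namespace Summit.QuantumFields.BalabanUV.T4Continuum.NE4ReadOutSocketTowerPerturbed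

open scoped Matrix Matrix.Norms.L2Operator
open Literature.MathematicalPhysics.QuantumFieldTheory.Balaban1983to89
open FlowStep (HBeta RGEqH Box)
open T4OutputRate (Carriers Functional NE5 NE9 LipBackground DecayBound)
open T4CouplingMatching (disc ScaleShiftRate HistLipschitz)
open T4CauchySum (InjectedRate)
open T4EtaRateMin (Readings LocalRate)
open T4RateLiaison (GaugeDominated)
open T4TowerRateComposition (URateUpTo PolyLipGrowth)
open T4BetaReadOut (Slice ReadOut RepresentsA RepresentsB)
open T4BetaReadOutLipschitz (ReadBoundedOn ReadCovariantOn)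
open T4FlagMemory (extd)
open T4HistoryLipschitzRecursion (prodModuli ScaleZeroFree AdmissibleTerms AdmRestrict ChannelAdditive ChannelStepSum
  ChannelSizeAtStepNN)
open T4HistoryLipschitzOuter (Factorises)
open T4HistoryLipschitzActivity (ClusterGeom)
open T4HistoryLipschitzSegment (TwoPointKP)
open T4InputCauchyRateData (StepModel)
open OutputRateInsertion (InsOpModel)
open OutputRateTowerSocket (ReadsTowerMid)
open BackgroundResolventTower (FreeTowerLaws PerturbationLaws Cpert)
open OutputRateTowerInstance (pertTower towerContracting_perturbed towerLaw_perturbed Cpert_nonneg)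
open NE4ReadOutSocketTower (ne4_of_endNE9_towerSplitIns injectedRate_of_endNE9_towerSplitIns
  uRateUpTo_of_endNE9_towerSplitIns)

variable {C : Carriers} {ι X : Type}

/-! ## §1 The row's triple at node U2, row NE5's W1 read from perturbed free towers (no law binder) ∧ row NE3's `LocalRate` -/

/-- **ROW NE4 — NODE U2's TRIPLE FROM ROW NE9's END THEOREM, ROW NE5's RESIDUAL WITH W1 := ROW NE2's PERTURBED-TOWER THEOREM
(U = 1 bundle `hfree` ∧ per-background `hpert : PerturbationLaws` ∧ defects ∧ `‖t‖κP < 1`) ∧ ROW NE3's `LocalRate`, W4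
PRODUCED, AND THE READ-OUT (R), BY NAME.**  = `NE4ReadOutSocketTower.ne4_of_endNE9_towerSplitIns` with `hAt :=
towerContracting_perturbed hfree`, `hlaw := towerLaw_perturbed hrt hfree hpert h₀ h₁ h₂ hf ht`, `hCop := Cpert_nonneg …`;
`hδ₁ : cR·Cpert κP C₀ C₁ C₂ C_f t/r₀ + Λb·Cm = δ₁`.  No binder of η-rate LAW type from row NE2 remains. [folklore] -/
theorem ne4_of_endNE9_perturbedSplitIns (G : ClusterGeom C) {Pot : Type*} [NormedAddCommGroup Pot] [NormedSpace ℂ Pot]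
    {Op Hist : Type*} [NormedAddCommGroup Op] [NormedSpace ℂ Op] [NormedAddCommGroup Hist] [NormedSpace ℂ Hist]
    [CompleteSpace Hist] {ιf : ℕ → Type*} [∀ k, Fintype (ιf k)] [∀ k, DecidableEq (ιf k)] {Jx : Type*}
    (Mf : ℝ → StepModel C Op Hist) (Insf : ℝ → ℕ → Op → (C.Dom → ℝ) → Hist) {ιc : Type} {EA : Functional C C.BgA} {W : Set (ℕ → ℝ)}
    {Adm : Set (C.BgA → C.Dom → ℝ)} {T : ℕ → (ℕ → ℝ) → (C.BgA → C.Dom → ℝ) → ιc → ℝ}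
    {Ψ : ℕ → ℝ → (ιc → ℝ) → C.BgA → C.Dom → ℝ} {act : ℕ → ℝ → C.BgA → Pot → G.P → ℂ} {𝒜 : ℕ → Set Pot}
    {n : ℕ → ℝ → C.BgA → G.P → ℝ} {lip clip : ℕ → ℝ} {aP dP : G.P → ℝ} {δ : C.Dom → ℝ}
    {κ B lipbar clipbar pexbar qTbar τbar ω ℓ ν : ℝ} {wt : ℕ → ιc → ℝ} {τ : ℕ → ℕ → ℝ} {pex qT : ℕ → ℝ}
    (ρT : ℕ → (ιc → ℝ) → Pot) (expl : ℕ → ℝ → C.BgA → C.Dom → ℝ)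
    -- ===== row NE9's END theorem: the binders of `ne9_and_fadingMemory_of_couplingTwoPoint`, verbatim =====
    (h0 : ScaleZeroFree EA W) (hAdm : AdmissibleTerms EA W Adm) (hres : AdmRestrict Adm) (hadd : ChannelAdditive Adm T)
    (hsum : ChannelStepSum Adm T) (hstep : ChannelSizeAtStepNN Adm T κ wt τ) (hfac : Factorises EA W T Ψ)
    (hclip0 : ∀ k, 0 ≤ clip k)
    (hCup : ∀ g ∈ W, ∀ g' ∈ W, ∀ (k : ℕ) (U : C.BgA) (X : C.Dom), C.scale X = k + 1 → ∀ Q ∈ 𝒜 k, ∀ γ ∈ G.vol X,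
      ‖act k (g k) U Q γ‖ ≤ n k (g' k) U γ ∧
        ‖act k (g k) U Q γ - act k (g' k) U Q γ‖ ≤ clip k * |g k - g' k| * n k (g' k) U γ)
    (hqT0 : ∀ k, 0 ≤ qT k)
    (hTcup : ∀ g ∈ W, ∀ g' ∈ W, ∀ (k : ℕ) (y : ιc), |T k g (EA g) y - T k g' (EA g) y| ≤ wt k y * (qT k * |g k - g' k|))
    (hrepr : ∀ (k : ℕ) (s : ℝ) (P : ιc → ℝ) (U : C.BgA) (X : C.Dom),
      Ψ k s P U X = (G.newTerm act k s U X (ρT k P)).re + expl k s U X)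
    (hexpl : ∀ g ∈ W, ∀ g' ∈ W, ∀ (k : ℕ) (U : C.BgA) (X : C.Dom), C.scale X = k + 1 →
      |expl k (g k) U X - expl k (g' k) U X| ≤ Real.exp (-(κ * C.d X)) * (pex k * |g k - g' k|))
    (hclipb : ∀ k, clip k ≤ clipbar) (hpexb : ∀ k, pex k ≤ pexbar) (hpexbar : 0 ≤ pexbar) (hqTb : ∀ k, qT k ≤ qTbar)
    (hKP : TwoPointKP G W act 𝒜 n lip aP dP) (hdec : G.DecayExtract δ dP) (hpinB : G.PinBudget aP δ (fun _ => B) κ)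
    (hρT : ∀ (k : ℕ) (P P' : ιc → ℝ) (M : ℝ), (∀ y, |P y - P' y| ≤ wt k y * M) → ‖ρT k P - ρT k P'‖ ≤ M)
    (hocc : ∀ g ∈ W, ∀ g' ∈ W, ∀ k : ℕ, ρT k (T k g' (EA g)) ∈ 𝒜 k) (hB0 : 0 ≤ B)
    (hlipb : ∀ k, lip k ≤ lipbar) (hτbar : 0 ≤ τbar) (hω : 0 ≤ ω) (hpos : 0 < ω + 4 * lipbar * B * τbar)
    (hτ : ∀ k j, j ≤ k → 0 ≤ τ k j ∧ τ k j ≤ τbar * ω ^ (k - j))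
    (hℓ : 4 * clipbar * B + pexbar + 4 * lipbar * B * qTbar = ℓ) (hν : ω + 4 * lipbar * B * τbar = ν)
    -- ===== row NE5's END, PERTURBED-tower split face: U = 1 bundle, per-background PerturbationLaws, defects, coupling; then as before =====
    {D : (k : ℕ) → Matrix (ιf k) (ιf k) ℂ} {A : (k : ℕ) → Matrix (ιf k) (ιf (k + 1)) ℂ}
    {Jinj : (k : ℕ) → Matrix (ιf (k + 1)) (ιf k) ℂ} {F : (k : ℕ) → Matrix (ιf k) (ιf k) ℂ} {r κP : ℝ} {e₀ e₁ f : ℕ → ℝ}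
    {e₂ : Jx → ℕ → ℝ} {P : Jx → (k : ℕ) → Matrix (ιf k) (ιf k) ℂ} {C₀ C₁ C₂ Cf : ℝ} {t : ℂ} {θ₂ cR r₀ Λb Cm : ℝ} (towf : ℝ → ℕ → (ℕ → ℝ) → C.BgB → Jx) (opMidf : ℝ → (ℕ → ℝ) → C.BgB → ℕ → Op)
    (distf : ℝ → ℕ → (ℕ → ℝ) → C.BgB → ℝ) {ιR XR : Type*} (R₃ : Readings ιR XR)
    {EBfam : ℝ → Functional C C.BgB} {γ Λ₅ EA₀ E₀ Gi ρ₁ δ₁ δ₅ θ₁ θ₅ c₅ ω₅ ρ₀ B₅ C₅ : ℝ} {k₅ k₁ : ℕ}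
    (hrt : 0 < r) (hfree : FreeTowerLaws D A Jinj F r e₀ e₁ f)
    (hpert : ∀ j, PerturbationLaws D (P j) Jinj κP (e₂ j)) (h₀ : ∀ k, e₀ k ≤ C₀ * θ₂ ^ k) (h₁ : ∀ k, e₁ k ≤ C₁ * θ₂ ^ k)
    (h₂ : ∀ j k, e₂ j k ≤ C₂ * θ₂ ^ k) (hf : ∀ k, f k ≤ Cf * θ₂ ^ k) (hC₀ : 0 ≤ C₀) (hC₁ : 0 ≤ C₁) (hC₂ : 0 ≤ C₂)
    (hCf : 0 ≤ Cf) (ht : ‖t‖ * κP < 1)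
    (hreadf : ∀ b', 0 < b' → b' ≤ γ → ReadsTowerMid (Mf b') (fun _ : Jx => A) (pertTower D P t) r W cR (towf b') (opMidf b'))
    (hcR : 0 ≤ cR) (hθ₂ : 0 ≤ θ₂) (hθ₂₁ : θ₂ ≤ θ₁)
    (hflf : ∀ b', 0 < b' → b' ≤ γ → ∀ k, r₀ ≤ (Mf b').rOp k) (hr₀ : 0 < r₀)
    (hLipf : ∀ b', 0 < b' → b' ≤ γ → ∀ k, ∀ g ∈ W, ∀ (U : C.BgB),
      ‖opMidf b' g U k - (Mf b').opB g U k‖ ≤ Λb * distf b' k g U * (Mf b').rOp k) (hΛb : 0 ≤ Λb)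
    (hR₃ : LocalRate R₃ Cm θ₁) (hCm : 0 ≤ Cm)
    (hdomf : ∀ b', 0 < b' → b' ≤ γ → ∀ k, ∀ g ∈ W, ∀ (U : C.BgB),
      ∃ V ∈ R₃.dom, ∃ x : XR, distf b' k g U ≤ |R₃.loc (k + 1) V x - R₃.loc k V x|)
    (hdA : DecayBound EA W EA₀ κ)
    (hrAf : ∀ b', 0 < b' → b' ≤ γ → (Mf b').RepresentsA EA W)
    (hrBf : ∀ b', 0 < b' → b' ≤ γ → (Mf b').RepresentsB (EBfam b') W)
    (hbasef : ∀ b', 0 < b' → b' ≤ γ → (Mf b').InBase (EBfam b') W)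
    (hlipf : ∀ b', 0 < b' → b' ≤ γ → (Mf b').DataLipschitz W κ Λ₅ ρ₀)
    (hdBf : ∀ b', 0 < b' → b' ≤ γ → DecayBound (EBfam b') W E₀ κ)
    (hreadIf : ∀ b', 0 < b' → b' ≤ γ → (InsOpModel.ofStep (Mf b') (Insf b')).ReadsIns W)
    (hienvf : ∀ b', 0 < b' → b' ≤ γ → (InsOpModel.ofStep (Mf b') (Insf b')).InsOpEnvelope W κ E₀ Gi)
    (hbdAf : ∀ b', 0 < b' → b' ≤ γ → (InsOpModel.ofStep (Mf b') (Insf b')).InsBoundA W κ E₀ Gi)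
    (hdampf : ∀ b', 0 < b' → b' ≤ γ → (Mf b').InsertionDampedNat W κ c₅ ω₅)
    (hδ₁ : cR * Cpert κP C₀ C₁ C₂ Cf t / r₀ + Λb * Cm = δ₁) (hGi : 0 ≤ Gi) (hρ₁ : ρ₁ < 1) (hreach : δ₁ * θ₁ ^ k₁ ≤ ρ₁)
    (hδ₅ : Gi * δ₁ / (1 - ρ₁) + 2 * Gi / θ₁ ^ k₁ = δ₅)
    (hΛ₅ : 0 ≤ Λ₅) (hθ₁ : 0 < θ₁) (hθ₁₅ : θ₁ ≤ θ₅) (hθ₅1 : θ₅ ≤ 1) (hc₅ : 0 ≤ c₅) (hω₅ : 0 < ω₅)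
    (hnear : (δ₁ + δ₅) * θ₁ ^ k₅ + c₅ * (EA₀ + E₀) / (1 - ω₅) ≤ ρ₀) (hB₅ : 0 ≤ B₅)
    (hfirst : ∀ k < k₅, EA₀ + E₀ ≤ B₅ * θ₁ ^ k) (hsmall5 : ω₅ + Λ₅ * c₅ < θ₅)
    (hC₅ : (Λ₅ * (δ₁ + δ₅) + B₅) * (θ₅ - ω₅) / (θ₅ - (ω₅ + Λ₅ * c₅)) = C₅)
    -- ===== node U2's read-out (R) =====
    {𝒜A : Set (Slice C C.BgA)} {𝒜B : Set (Slice C C.BgB)} {rA : ReadOut C C.BgA} {rB : ReadOut C C.BgB} {β : HBeta}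
    {cr : ℝ} (hW : ∀ k (v : Fin (k + 1) → ℝ), v ∈ Box γ k → extd v ∈ W)
    (hA : RepresentsA EA rA γ β) (hB : RepresentsB EBfam rB γ β)
    (h𝒜A : ∀ g' ∈ W, EA g' ∈ 𝒜A) (h𝒜B : ∀ b', 0 < b' → b' ≤ γ → ∀ g' ∈ W, EBfam b' g' ∈ 𝒜B)
    (hr : ReadBoundedOn 𝒜A rA κ cr) (hcov : ReadCovariantOn 𝒜A 𝒜B rA rB κ cr) (hcr : 0 ≤ cr) :
    ScaleShiftRate (cr * C₅ * θ₅) θ₅ γ β ∧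
      HistLipschitz (fun k i => cr * prodModuli ℓ (fun _ => ν) (k + 1) i) γ β ∧
        T4CouplingMatching.FadingMemory (cr * (ℓ / ν) * ν) ν (fun k i => cr * prodModuli ℓ (fun _ => ν) (k + 1) i) :=
  ne4_of_endNE9_towerSplitIns G Mf Insf ρT expl h0 hAdm hres hadd hsum hstep hfac hclip0 hCup hqT0
    hTcup hrepr hexpl hclipb hpexb hpexbar hqTb hKP hdec hpinB hρT hocc hB0 hlipb hτbar hω hpos hτ hℓ hν towf opMidf
    distf R₃ hrt (towerContracting_perturbed hfree) (towerLaw_perturbed hrt hfree hpert h₀ h₁ h₂ hf ht) hreadf hcR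
    (Cpert_nonneg ht hC₀ hC₁ hC₂ hCf) hθ₂ hθ₂₁ hflf hr₀ hLipf hΛb hR₃ hCm hdomf hdA hrAf hrBf hbasef hlipf hdBf hreadIf
    hienvf hbdAf hdampf hδ₁ hGi hρ₁ hreach hδ₅ hΛ₅ hθ₁ hθ₁₅ hθ₅1 hc₅ hω₅ hnear hB₅ hfirst hsmall5 hC₅ hW hA hB h𝒜A h𝒜B
    hr hcov hcr

/-! ## §2 Node U2's output in the spine's currency (gap route, no asymptotic-freedom input) -/

/-- **ROW NE4 — NODE U2's OUTPUT `InjectedRate`, SAME INPUTS + THE RUNS, BY NAME** (`NE4ReadOutSocketTower.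
injectedRate_of_endNE9_towerSplitIns` on the perturbed-tower instance).  NO `EventualLowerH`, NO `0 < b`. [folklore] -/
theorem injectedRate_of_endNE9_perturbedSplitIns (G : ClusterGeom C) {Pot : Type*} [NormedAddCommGroup Pot]
    [NormedSpace ℂ Pot] {Op Hist : Type*} [NormedAddCommGroup Op] [NormedSpace ℂ Op] [NormedAddCommGroup Hist]
    [NormedSpace ℂ Hist] [CompleteSpace Hist] {ιf : ℕ → Type*} [∀ k, Fintype (ιf k)] [∀ k, DecidableEq (ιf k)] {Jx : Type*}
    (Mf : ℝ → StepModel C Op Hist) (Insf : ℝ → ℕ → Op → (C.Dom → ℝ) → Hist) {ιc : Type} {EA : Functional C C.BgA} {W : Set (ℕ → ℝ)}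
    {Adm : Set (C.BgA → C.Dom → ℝ)} {T : ℕ → (ℕ → ℝ) → (C.BgA → C.Dom → ℝ) → ιc → ℝ}
    {Ψ : ℕ → ℝ → (ιc → ℝ) → C.BgA → C.Dom → ℝ} {act : ℕ → ℝ → C.BgA → Pot → G.P → ℂ} {𝒜 : ℕ → Set Pot}
    {n : ℕ → ℝ → C.BgA → G.P → ℝ} {lip clip : ℕ → ℝ} {aP dP : G.P → ℝ} {δ : C.Dom → ℝ}
    {κ B lipbar clipbar pexbar qTbar τbar ω ℓ ν : ℝ} {wt : ℕ → ιc → ℝ} {τ : ℕ → ℕ → ℝ} {pex qT : ℕ → ℝ}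
    (ρT : ℕ → (ιc → ℝ) → Pot) (expl : ℕ → ℝ → C.BgA → C.Dom → ℝ)
    (h0 : ScaleZeroFree EA W) (hAdm : AdmissibleTerms EA W Adm) (hres : AdmRestrict Adm) (hadd : ChannelAdditive Adm T)
    (hsum : ChannelStepSum Adm T) (hstep : ChannelSizeAtStepNN Adm T κ wt τ) (hfac : Factorises EA W T Ψ)
    (hclip0 : ∀ k, 0 ≤ clip k)
    (hCup : ∀ g ∈ W, ∀ g' ∈ W, ∀ (k : ℕ) (U : C.BgA) (X : C.Dom), C.scale X = k + 1 → ∀ Q ∈ 𝒜 k, ∀ γ ∈ G.vol X,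
      ‖act k (g k) U Q γ‖ ≤ n k (g' k) U γ ∧
        ‖act k (g k) U Q γ - act k (g' k) U Q γ‖ ≤ clip k * |g k - g' k| * n k (g' k) U γ)
    (hqT0 : ∀ k, 0 ≤ qT k)
    (hTcup : ∀ g ∈ W, ∀ g' ∈ W, ∀ (k : ℕ) (y : ιc), |T k g (EA g) y - T k g' (EA g) y| ≤ wt k y * (qT k * |g k - g' k|))
    (hrepr : ∀ (k : ℕ) (s : ℝ) (P : ιc → ℝ) (U : C.BgA) (X : C.Dom),
      Ψ k s P U X = (G.newTerm act k s U X (ρT k P)).re + expl k s U X)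
    (hexpl : ∀ g ∈ W, ∀ g' ∈ W, ∀ (k : ℕ) (U : C.BgA) (X : C.Dom), C.scale X = k + 1 →
      |expl k (g k) U X - expl k (g' k) U X| ≤ Real.exp (-(κ * C.d X)) * (pex k * |g k - g' k|))
    (hclipb : ∀ k, clip k ≤ clipbar) (hpexb : ∀ k, pex k ≤ pexbar) (hpexbar : 0 ≤ pexbar) (hqTb : ∀ k, qT k ≤ qTbar)
    (hKP : TwoPointKP G W act 𝒜 n lip aP dP) (hdec : G.DecayExtract δ dP) (hpinB : G.PinBudget aP δ (fun _ => B) κ)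
    (hρT : ∀ (k : ℕ) (P P' : ιc → ℝ) (M : ℝ), (∀ y, |P y - P' y| ≤ wt k y * M) → ‖ρT k P - ρT k P'‖ ≤ M)
    (hocc : ∀ g ∈ W, ∀ g' ∈ W, ∀ k : ℕ, ρT k (T k g' (EA g)) ∈ 𝒜 k) (hB0 : 0 ≤ B)
    (hlipb : ∀ k, lip k ≤ lipbar) (hτbar : 0 ≤ τbar) (hω : 0 ≤ ω) (hpos : 0 < ω + 4 * lipbar * B * τbar)
    (hτ : ∀ k j, j ≤ k → 0 ≤ τ k j ∧ τ k j ≤ τbar * ω ^ (k - j))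
    (hℓ : 4 * clipbar * B + pexbar + 4 * lipbar * B * qTbar = ℓ) (hν : ω + 4 * lipbar * B * τbar = ν)
    {D : (k : ℕ) → Matrix (ιf k) (ιf k) ℂ} {A : (k : ℕ) → Matrix (ιf k) (ιf (k + 1)) ℂ}
    {Jinj : (k : ℕ) → Matrix (ιf (k + 1)) (ιf k) ℂ} {F : (k : ℕ) → Matrix (ιf k) (ιf k) ℂ} {r κP : ℝ} {e₀ e₁ f : ℕ → ℝ}
    {e₂ : Jx → ℕ → ℝ} {P : Jx → (k : ℕ) → Matrix (ιf k) (ιf k) ℂ} {C₀ C₁ C₂ Cf : ℝ} {t : ℂ} {θ₂ cR r₀ Λb Cm : ℝ} (towf : ℝ → ℕ → (ℕ → ℝ) → C.BgB → Jx) (opMidf : ℝ → (ℕ → ℝ) → C.BgB → ℕ → Op)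
    (distf : ℝ → ℕ → (ℕ → ℝ) → C.BgB → ℝ) {ιR XR : Type*} (R₃ : Readings ιR XR)
    {EBfam : ℝ → Functional C C.BgB} {γ Λ₅ EA₀ E₀ Gi ρ₁ δ₁ δ₅ θ₁ θ₅ c₅ ω₅ ρ₀ B₅ C₅ : ℝ} {k₅ k₁ : ℕ}
    (hrt : 0 < r) (hfree : FreeTowerLaws D A Jinj F r e₀ e₁ f)
    (hpert : ∀ j, PerturbationLaws D (P j) Jinj κP (e₂ j)) (h₀ : ∀ k, e₀ k ≤ C₀ * θ₂ ^ k) (h₁ : ∀ k, e₁ k ≤ C₁ * θ₂ ^ k)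
    (h₂ : ∀ j k, e₂ j k ≤ C₂ * θ₂ ^ k) (hf : ∀ k, f k ≤ Cf * θ₂ ^ k) (hC₀ : 0 ≤ C₀) (hC₁ : 0 ≤ C₁) (hC₂ : 0 ≤ C₂)
    (hCf : 0 ≤ Cf) (ht : ‖t‖ * κP < 1)
    (hreadf : ∀ b', 0 < b' → b' ≤ γ → ReadsTowerMid (Mf b') (fun _ : Jx => A) (pertTower D P t) r W cR (towf b') (opMidf b'))
    (hcR : 0 ≤ cR) (hθ₂ : 0 ≤ θ₂) (hθ₂₁ : θ₂ ≤ θ₁)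
    (hflf : ∀ b', 0 < b' → b' ≤ γ → ∀ k, r₀ ≤ (Mf b').rOp k) (hr₀ : 0 < r₀)
    (hLipf : ∀ b', 0 < b' → b' ≤ γ → ∀ k, ∀ g ∈ W, ∀ (U : C.BgB),
      ‖opMidf b' g U k - (Mf b').opB g U k‖ ≤ Λb * distf b' k g U * (Mf b').rOp k) (hΛb : 0 ≤ Λb)
    (hR₃ : LocalRate R₃ Cm θ₁) (hCm : 0 ≤ Cm)
    (hdomf : ∀ b', 0 < b' → b' ≤ γ → ∀ k, ∀ g ∈ W, ∀ (U : C.BgB),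
      ∃ V ∈ R₃.dom, ∃ x : XR, distf b' k g U ≤ |R₃.loc (k + 1) V x - R₃.loc k V x|)
    (hdA : DecayBound EA W EA₀ κ)
    (hrAf : ∀ b', 0 < b' → b' ≤ γ → (Mf b').RepresentsA EA W)
    (hrBf : ∀ b', 0 < b' → b' ≤ γ → (Mf b').RepresentsB (EBfam b') W)
    (hbasef : ∀ b', 0 < b' → b' ≤ γ → (Mf b').InBase (EBfam b') W)
    (hlipf : ∀ b', 0 < b' → b' ≤ γ → (Mf b').DataLipschitz W κ Λ₅ ρ₀)
    (hdBf : ∀ b', 0 < b' → b' ≤ γ → DecayBound (EBfam b') W E₀ κ)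
    (hreadIf : ∀ b', 0 < b' → b' ≤ γ → (InsOpModel.ofStep (Mf b') (Insf b')).ReadsIns W)
    (hienvf : ∀ b', 0 < b' → b' ≤ γ → (InsOpModel.ofStep (Mf b') (Insf b')).InsOpEnvelope W κ E₀ Gi)
    (hbdAf : ∀ b', 0 < b' → b' ≤ γ → (InsOpModel.ofStep (Mf b') (Insf b')).InsBoundA W κ E₀ Gi)
    (hdampf : ∀ b', 0 < b' → b' ≤ γ → (Mf b').InsertionDampedNat W κ c₅ ω₅)
    (hδ₁ : cR * Cpert κP C₀ C₁ C₂ Cf t / r₀ + Λb * Cm = δ₁) (hGi : 0 ≤ Gi) (hρ₁ : ρ₁ < 1) (hreach : δ₁ * θ₁ ^ k₁ ≤ ρ₁)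
    (hδ₅ : Gi * δ₁ / (1 - ρ₁) + 2 * Gi / θ₁ ^ k₁ = δ₅)
    (hΛ₅ : 0 ≤ Λ₅) (hθ₁ : 0 < θ₁) (hθ₁₅ : θ₁ ≤ θ₅) (hθ₅1 : θ₅ ≤ 1) (hc₅ : 0 ≤ c₅) (hω₅ : 0 < ω₅)
    (hnear : (δ₁ + δ₅) * θ₁ ^ k₅ + c₅ * (EA₀ + E₀) / (1 - ω₅) ≤ ρ₀) (hB₅ : 0 ≤ B₅)
    (hfirst : ∀ k < k₅, EA₀ + E₀ ≤ B₅ * θ₁ ^ k) (hsmall5 : ω₅ + Λ₅ * c₅ < θ₅)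
    (hC₅ : (Λ₅ * (δ₁ + δ₅) + B₅) * (θ₅ - ω₅) / (θ₅ - (ω₅ + Λ₅ * c₅)) = C₅)
    {𝒜A : Set (Slice C C.BgA)} {𝒜B : Set (Slice C C.BgB)} {rA : ReadOut C C.BgA} {rB : ReadOut C C.BgB} {β : HBeta}
    {cr : ℝ} (hW : ∀ k (v : Fin (k + 1) → ℝ), v ∈ Box γ k → extd v ∈ W)
    (hA : RepresentsA EA rA γ β) (hB : RepresentsB EBfam rB γ β)
    (h𝒜A : ∀ g' ∈ W, EA g' ∈ 𝒜A) (h𝒜B : ∀ b', 0 < b' → b' ≤ γ → ∀ g' ∈ W, EBfam b' g' ∈ 𝒜B)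
    (hr : ReadBoundedOn 𝒜A rA κ cr) (hcov : ReadCovariantOn 𝒜A 𝒜B rA rB κ cr) (hcr : 0 ≤ cr)
    -- ===== node U1/H3's runs, the rates and the window =====
    {ρ : ℝ} (g : ℕ → ℕ → ℝ) (gIR : ℝ) (hθ₅ρ : θ₅ ≤ ρ) (hνρ : ν < ρ) (hρ0 : 0 < ρ) (hρ1 : ρ < 1) (hγ : 0 ≤ γ)
    (hrun : ∀ K, RGEqH K β (g K)) (hbox : ∀ K i, i ≤ K → 0 < g K i ∧ g K i ≤ γ) (hpin : ∀ K, g K K = gIR)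
    (hsmall : cr * (ℓ / ν) * ν * (γ ^ 3 / 2) * (ρ / (ρ - ν)) ≤ (1 - ρ) / 2) :
    InjectedRate (2 * (cr * C₅ * θ₅) / (1 - ρ)) 0 ρ (fun K j => disc (g K) (g (K + 1)) j) :=
  injectedRate_of_endNE9_towerSplitIns G Mf Insf ρT expl h0 hAdm hres hadd hsum hstep hfac hclip0 hCup hqT0
    hTcup hrepr hexpl hclipb hpexb hpexbar hqTb hKP hdec hpinB hρT hocc hB0 hlipb hτbar hω hpos hτ hℓ hν towf opMidf
    distf R₃ hrt (towerContracting_perturbed hfree) (towerLaw_perturbed hrt hfree hpert h₀ h₁ h₂ hf ht) hreadf hcR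
    (Cpert_nonneg ht hC₀ hC₁ hC₂ hCf) hθ₂ hθ₂₁ hflf hr₀ hLipf hΛb hR₃ hCm hdomf hdA hrAf hrBf hbasef hlipf hdBf hreadIf
    hienvf hbdAf hdampf hδ₁ hGi hρ₁ hreach hδ₅ hΛ₅ hθ₁ hθ₁₅ hθ₅1 hc₅ hω₅ hnear hB₅ hfirst hsmall5 hC₅ hW hA hB h𝒜A h𝒜B
    hr hcov hcr g gIR hθ₅ρ hνρ hρ0 hρ1 hγ hrun hbox hpin hsmall

/-! ## §3 The spine's `K`-uniform term-wise matching, tower pair and read-out family read from the same perturbed towers -/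

/-- **ROW NE4 IN THE SPINE — `URateUpTo K`, `K`-UNIFORM, ROW NE5's W1 FROM PERTURBED FREE TOWERS (no law binder), W4
PRODUCED** (`NE4ReadOutSocketTower.uRateUpTo_of_endNE9_towerSplitIns` on the instance; the tower pair (`EA`, `EB`) through ONE
`M` and the read-out family through `Mf b′`, both read (`ReadsTowerMid`) from the perturbed towers `pertTower D P t`; node U1b
`hU`/`hG`/`hP`, nodes U5/U6 `hloc` (the spine's OWN carrier `R` ≠ `R₃`) / `hgd`, the runs in `W`, target rate `θ′ > max ν ρ`).
[folklore] -/
theorem uRateUpTo_of_endNE9_perturbedSplitIns (G : ClusterGeom C) {Pot : Type*} [NormedAddCommGroup Pot]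
    [NormedSpace ℂ Pot] {Op Hist : Type*} [NormedAddCommGroup Op] [NormedSpace ℂ Op] [NormedAddCommGroup Hist]
    [NormedSpace ℂ Hist] [CompleteSpace Hist] {ιf : ℕ → Type*} [∀ k, Fintype (ιf k)] [∀ k, DecidableEq (ιf k)] {Jx : Type*}
    (M : StepModel C Op Hist) (Ins : ℕ → Op → (C.Dom → ℝ) → Hist) (Mf : ℝ → StepModel C Op Hist)
    (Insf : ℝ → ℕ → Op → (C.Dom → ℝ) → Hist) {ιc : Type} {EA : Functional C C.BgA} {W : Set (ℕ → ℝ)}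
    {Adm : Set (C.BgA → C.Dom → ℝ)} {T : ℕ → (ℕ → ℝ) → (C.BgA → C.Dom → ℝ) → ιc → ℝ}
    {Ψ : ℕ → ℝ → (ιc → ℝ) → C.BgA → C.Dom → ℝ} {act : ℕ → ℝ → C.BgA → Pot → G.P → ℂ} {𝒜 : ℕ → Set Pot}
    {n : ℕ → ℝ → C.BgA → G.P → ℝ} {lip clip : ℕ → ℝ} {aP dP : G.P → ℝ} {δ : C.Dom → ℝ}
    {κ B lipbar clipbar pexbar qTbar τbar ω ℓ ν : ℝ} {wt : ℕ → ιc → ℝ} {τ : ℕ → ℕ → ℝ} {pex qT : ℕ → ℝ}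
    (ρT : ℕ → (ιc → ℝ) → Pot) (expl : ℕ → ℝ → C.BgA → C.Dom → ℝ)
    -- ===== row NE9's END theorem =====
    (h0 : ScaleZeroFree EA W) (hAdm : AdmissibleTerms EA W Adm) (hres : AdmRestrict Adm) (hadd : ChannelAdditive Adm T)
    (hsum : ChannelStepSum Adm T) (hstep : ChannelSizeAtStepNN Adm T κ wt τ) (hfac : Factorises EA W T Ψ)
    (hclip0 : ∀ k, 0 ≤ clip k)
    (hCup : ∀ g ∈ W, ∀ g' ∈ W, ∀ (k : ℕ) (U : C.BgA) (X : C.Dom), C.scale X = k + 1 → ∀ Q ∈ 𝒜 k, ∀ γ ∈ G.vol X,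
      ‖act k (g k) U Q γ‖ ≤ n k (g' k) U γ ∧
        ‖act k (g k) U Q γ - act k (g' k) U Q γ‖ ≤ clip k * |g k - g' k| * n k (g' k) U γ)
    (hqT0 : ∀ k, 0 ≤ qT k)
    (hTcup : ∀ g ∈ W, ∀ g' ∈ W, ∀ (k : ℕ) (y : ιc), |T k g (EA g) y - T k g' (EA g) y| ≤ wt k y * (qT k * |g k - g' k|))
    (hrepr : ∀ (k : ℕ) (s : ℝ) (P : ιc → ℝ) (U : C.BgA) (X : C.Dom),
      Ψ k s P U X = (G.newTerm act k s U X (ρT k P)).re + expl k s U X)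
    (hexpl : ∀ g ∈ W, ∀ g' ∈ W, ∀ (k : ℕ) (U : C.BgA) (X : C.Dom), C.scale X = k + 1 →
      |expl k (g k) U X - expl k (g' k) U X| ≤ Real.exp (-(κ * C.d X)) * (pex k * |g k - g' k|))
    (hclipb : ∀ k, clip k ≤ clipbar) (hpexb : ∀ k, pex k ≤ pexbar) (hpexbar : 0 ≤ pexbar) (hqTb : ∀ k, qT k ≤ qTbar)
    (hKP : TwoPointKP G W act 𝒜 n lip aP dP) (hdec : G.DecayExtract δ dP) (hpinB : G.PinBudget aP δ (fun _ => B) κ)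
    (hρT : ∀ (k : ℕ) (P P' : ιc → ℝ) (M : ℝ), (∀ y, |P y - P' y| ≤ wt k y * M) → ‖ρT k P - ρT k P'‖ ≤ M)
    (hocc : ∀ g ∈ W, ∀ g' ∈ W, ∀ k : ℕ, ρT k (T k g' (EA g)) ∈ 𝒜 k) (hB0 : 0 ≤ B)
    (hlipb : ∀ k, lip k ≤ lipbar) (hτbar : 0 ≤ τbar) (hω : 0 ≤ ω) (hpos : 0 < ω + 4 * lipbar * B * τbar)
    (hτ : ∀ k j, j ≤ k → 0 ≤ τ k j ∧ τ k j ≤ τbar * ω ^ (k - j))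
    (hℓ : 4 * clipbar * B + pexbar + 4 * lipbar * B * qTbar = ℓ) (hν : ω + 4 * lipbar * B * τbar = ν)
    -- ===== row NE5's END, PERTURBED-tower split face: tower pair through `M`, read-out family through `Mf b′` =====
    {D : (k : ℕ) → Matrix (ιf k) (ιf k) ℂ} {A : (k : ℕ) → Matrix (ιf k) (ιf (k + 1)) ℂ}
    {Jinj : (k : ℕ) → Matrix (ιf (k + 1)) (ιf k) ℂ} {F : (k : ℕ) → Matrix (ιf k) (ιf k) ℂ} {r κP : ℝ} {e₀ e₁ f : ℕ → ℝ}
    {e₂ : Jx → ℕ → ℝ} {P : Jx → (k : ℕ) → Matrix (ιf k) (ιf k) ℂ} {C₀ C₁ C₂ Cf : ℝ} {t : ℂ} {θ₂ cR r₀ Λb Cm : ℝ} (tow : ℕ → (ℕ → ℝ) → C.BgB → Jx) (opMid : (ℕ → ℝ) → C.BgB → ℕ → Op)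
    (dist : ℕ → (ℕ → ℝ) → C.BgB → ℝ) (towf : ℝ → ℕ → (ℕ → ℝ) → C.BgB → Jx)
    (opMidf : ℝ → (ℕ → ℝ) → C.BgB → ℕ → Op) (distf : ℝ → ℕ → (ℕ → ℝ) → C.BgB → ℝ) {ιR XR : Type*}
    (R₃ : Readings ιR XR) {EB : Functional C C.BgB} {EBfam : ℝ → Functional C C.BgB}
    {γ Λ₅ EA₀ E₀ Gi ρ₁ δ₁ δ₅ θ₁ θ₅ c₅ ω₅ ρ₀ B₅ C₅ : ℝ} {k₅ k₁ : ℕ}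
    (hrt : 0 < r) (hfree : FreeTowerLaws D A Jinj F r e₀ e₁ f)
    (hpert : ∀ j, PerturbationLaws D (P j) Jinj κP (e₂ j)) (h₀ : ∀ k, e₀ k ≤ C₀ * θ₂ ^ k) (h₁ : ∀ k, e₁ k ≤ C₁ * θ₂ ^ k)
    (h₂ : ∀ j k, e₂ j k ≤ C₂ * θ₂ ^ k) (hf : ∀ k, f k ≤ Cf * θ₂ ^ k) (hC₀ : 0 ≤ C₀) (hC₁ : 0 ≤ C₁) (hC₂ : 0 ≤ C₂)
    (hCf : 0 ≤ Cf) (ht : ‖t‖ * κP < 1)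
    (hread : ReadsTowerMid M (fun _ : Jx => A) (pertTower D P t) r W cR tow opMid)
    (hreadf : ∀ b', 0 < b' → b' ≤ γ → ReadsTowerMid (Mf b') (fun _ : Jx => A) (pertTower D P t) r W cR (towf b') (opMidf b'))
    (hcR : 0 ≤ cR) (hθ₂ : 0 ≤ θ₂) (hθ₂₁ : θ₂ ≤ θ₁) (hfl : ∀ k, r₀ ≤ M.rOp k)
    (hflf : ∀ b', 0 < b' → b' ≤ γ → ∀ k, r₀ ≤ (Mf b').rOp k) (hr₀ : 0 < r₀)
    (hLip : ∀ k, ∀ g ∈ W, ∀ (U : C.BgB), ‖opMid g U k - M.opB g U k‖ ≤ Λb * dist k g U * M.rOp k)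
    (hLipf : ∀ b', 0 < b' → b' ≤ γ → ∀ k, ∀ g ∈ W, ∀ (U : C.BgB),
      ‖opMidf b' g U k - (Mf b').opB g U k‖ ≤ Λb * distf b' k g U * (Mf b').rOp k) (hΛb : 0 ≤ Λb)
    (hR₃ : LocalRate R₃ Cm θ₁) (hCm : 0 ≤ Cm)
    (hdom : ∀ k, ∀ g ∈ W, ∀ (U : C.BgB), ∃ V ∈ R₃.dom, ∃ x : XR, dist k g U ≤ |R₃.loc (k + 1) V x - R₃.loc k V x|)
    (hdomf : ∀ b', 0 < b' → b' ≤ γ → ∀ k, ∀ g ∈ W, ∀ (U : C.BgB),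
      ∃ V ∈ R₃.dom, ∃ x : XR, distf b' k g U ≤ |R₃.loc (k + 1) V x - R₃.loc k V x|)
    (hrA : M.RepresentsA EA W) (hrB : M.RepresentsB EB W) (hbase : M.InBase EB W) (hlip5 : M.DataLipschitz W κ Λ₅ ρ₀)
    (hdA : DecayBound EA W EA₀ κ) (hdB : DecayBound EB W E₀ κ) (hreadI : (InsOpModel.ofStep M Ins).ReadsIns W)
    (hienv : (InsOpModel.ofStep M Ins).InsOpEnvelope W κ E₀ Gi) (hbdA : (InsOpModel.ofStep M Ins).InsBoundA W κ E₀ Gi)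
    (hdamp : M.InsertionDampedNat W κ c₅ ω₅)
    (hrAf : ∀ b', 0 < b' → b' ≤ γ → (Mf b').RepresentsA EA W)
    (hrBf : ∀ b', 0 < b' → b' ≤ γ → (Mf b').RepresentsB (EBfam b') W)
    (hbasef : ∀ b', 0 < b' → b' ≤ γ → (Mf b').InBase (EBfam b') W)
    (hlipf : ∀ b', 0 < b' → b' ≤ γ → (Mf b').DataLipschitz W κ Λ₅ ρ₀)
    (hdBf : ∀ b', 0 < b' → b' ≤ γ → DecayBound (EBfam b') W E₀ κ)
    (hreadIf : ∀ b', 0 < b' → b' ≤ γ → (InsOpModel.ofStep (Mf b') (Insf b')).ReadsIns W)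
    (hienvf : ∀ b', 0 < b' → b' ≤ γ → (InsOpModel.ofStep (Mf b') (Insf b')).InsOpEnvelope W κ E₀ Gi)
    (hbdAf : ∀ b', 0 < b' → b' ≤ γ → (InsOpModel.ofStep (Mf b') (Insf b')).InsBoundA W κ E₀ Gi)
    (hdampf : ∀ b', 0 < b' → b' ≤ γ → (Mf b').InsertionDampedNat W κ c₅ ω₅)
    (hδ₁ : cR * Cpert κP C₀ C₁ C₂ Cf t / r₀ + Λb * Cm = δ₁) (hGi : 0 ≤ Gi) (hρ₁ : ρ₁ < 1) (hreach : δ₁ * θ₁ ^ k₁ ≤ ρ₁)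
    (hδ₅ : Gi * δ₁ / (1 - ρ₁) + 2 * Gi / θ₁ ^ k₁ = δ₅)
    (hΛ₅ : 0 ≤ Λ₅) (hθ₁ : 0 < θ₁) (hθ₁₅ : θ₁ ≤ θ₅) (hθ₅1 : θ₅ ≤ 1) (hc₅ : 0 ≤ c₅) (hω₅ : 0 < ω₅)
    (hnear : (δ₁ + δ₅) * θ₁ ^ k₅ + c₅ * (EA₀ + E₀) / (1 - ω₅) ≤ ρ₀) (hB₅ : 0 ≤ B₅)
    (hfirst : ∀ k < k₅, EA₀ + E₀ ≤ B₅ * θ₁ ^ k) (hsmall5 : ω₅ + Λ₅ * c₅ < θ₅)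
    (hC₅ : (Λ₅ * (δ₁ + δ₅) + B₅) * (θ₅ - ω₅) / (θ₅ - (ω₅ + Λ₅ * c₅)) = C₅)
    -- ===== node U2's read-out (R) =====
    {𝒜A : Set (Slice C C.BgA)} {𝒜B : Set (Slice C C.BgB)} {rA : ReadOut C C.BgA} {rB : ReadOut C C.BgB} {β : HBeta}
    {cr : ℝ} (hW : ∀ k (v : Fin (k + 1) → ℝ), v ∈ Box γ k → extd v ∈ W)
    (hA : RepresentsA EA rA γ β) (hB : RepresentsB EBfam rB γ β)
    (h𝒜A : ∀ g' ∈ W, EA g' ∈ 𝒜A) (h𝒜B : ∀ b', 0 < b' → b' ≤ γ → ∀ g' ∈ W, EBfam b' g' ∈ 𝒜B)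
    (hr : ReadBoundedOn 𝒜A rA κ cr) (hcov : ReadCovariantOn 𝒜A 𝒜B rA rB κ cr) (hcr : 0 ≤ cr)
    -- ===== node U1/H3's runs, the rates and the window =====
    {ρ : ℝ} {g : ℕ → ℕ → ℝ} (gIR : ℝ) (hθ₅ρ : θ₅ ≤ ρ) (hνρ : ν < ρ) (hρ0 : 0 < ρ) (hρ1 : ρ < 1) (hγ : 0 ≤ γ)
    (hrun : ∀ K, RGEqH K β (g K)) (hbox : ∀ K i, i ≤ K → 0 < g K i ∧ g K i ≤ γ) (hpin : ∀ K, g K K = gIR)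
    (hsmall : cr * (ℓ / ν) * ν * (γ ^ 3 / 2) * (ρ / (ρ - ν)) ≤ (1 - ρ) / 2)
    (hgA : ∀ K, g K ∈ W) (hgB : ∀ K, (fun i => g (K + 1) (i + 1)) ∈ W)
    -- ===== node U1b, nodes U5/U6, the target rate =====
    {R : Readings ι X} {C₃ θ₃ P θ' : ℝ} {q : ℕ} {CU : (ℕ → ℝ) → ℕ → ℝ} {uA : ℕ → ι → C.BgA} {uB : ℕ → ι → C.BgB}
    (hU : LipBackground EA W κ CU) (hG : PolyLipGrowth CU g P q) (hP : 0 ≤ P)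
    (hloc : LocalRate R C₃ θ₃) (hC₃ : 0 ≤ C₃) (hθ₃ : 0 ≤ θ₃) (hθ₃1 : θ₃ < 1) (hgd : GaugeDominated R uA uB)
    (hθ' : max ν ρ < θ') (hθ₅' : θ₅ ≤ θ') (hθ₃' : θ₃ ≤ θ') :
    ∃ a : ℝ, 0 ≤ a ∧ ∀ K, URateUpTo K EA EB (g K) (fun i => g (K + 1) (i + 1)) (uA K) (uB K) R.dom
      (a + ℓ / ν * (γ ^ 3 * (2 * (cr * C₅ * θ₅) / (1 - ρ))) * (θ' / (θ' - max ν ρ)) + C₅) θ' κ :=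
  uRateUpTo_of_endNE9_towerSplitIns G M Ins Mf Insf ρT expl h0 hAdm hres hadd hsum hstep hfac
    hclip0 hCup hqT0 hTcup hrepr hexpl hclipb hpexb hpexbar hqTb hKP hdec hpinB hρT hocc hB0 hlipb hτbar hω hpos hτ hℓ hν
    tow opMid dist towf opMidf distf R₃ hrt (towerContracting_perturbed hfree)
    (towerLaw_perturbed hrt hfree hpert h₀ h₁ h₂ hf ht) hread hreadf hcR (Cpert_nonneg ht hC₀ hC₁ hC₂ hCf) hθ₂ hθ₂₁ hfl
    hflf hr₀ hLip hLipf hΛb hR₃ hCm hdom hdomf hrA hrB hbase hlip5 hdA hdB hreadI hienv hbdA hdamp hrAf hrBf hbasef hlipf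
    hdBf hreadIf hienvf hbdAf hdampf hδ₁ hGi hρ₁ hreach hδ₅ hΛ₅ hθ₁ hθ₁₅ hθ₅1 hc₅ hω₅ hnear hB₅ hfirst hsmall5 hC₅ hW hA hB
    h𝒜A h𝒜B hr hcov hcr gIR hθ₅ρ hνρ hρ0 hρ1 hγ hrun hbox hpin hsmall hgA hgB hU hG hP hloc hC₃ hθ₃ hθ₃1 hgd hθ' hθ₅' hθ₃'

end Summit.QuantumFields.BalabanUV.T4Continuum.NE4ReadOutSocketTowerPerturbed

end
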